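import Literature.MathematicalPhysics.QuantumFieldTheory.Balaban1983to89.Beta.RemainderChain
import Literature.MathematicalPhysics.QuantumFieldTheory.Balaban1983to89.B12Carve26Sect5BetaHyp

/-!
# `Balaban1983to89.B12Thm2PrintSkeleton` — [Balaban1987RG1] Theorem 2: the statement (by name) and the PRINTED ROAD
# towards it as ONE chain of named hypothesis-structures over the tree's vocabulary, with the β-remainder estimates
# singled out by name, and the kernel-checked compositions (what the printed part gives; what the announced part adds)

CITATION HEADER (lean-in-tree rule 2026-08-18).  Source «[RG1]» = T. Bałaban, *Renormalization group approach to lattice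
gauge field theories. I. Generation of effective actions in a small field approximation and a coupling constant
renormalization in four dimensions*, Commun. Math. Phys. **109** (1987) 249–301, doi:10.1007/bf01215223 = tree key
[Balaban1987RG1] (cell paper B12 = «[I]»); held `paper:balaban1987-cmp109-rg-i-small-field` (journal page = PDF page + 248;
every sentence quoted below was re-read by this seat on pp. 255–264, 268–269, 290–298 of that text).  Secondary loci:
*II. Cluster expansions*, Commun. Math. Phys. **116** (1988) 1–22 [Balaban1988RG2Cluster] (the activity (2.41) p. 21 behind the
remainder chain); *Large field renormalization. II*, Commun. Math. Phys. **122** (1989) 355–392 [Balaban1989LargeFieldII] p. 355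
(*"The proof of Theorem 2, which is based on second order perturbative calculations, is very awkward and long … and has not
been published yet"*).

## What this module is (and is not)

THEOREM 2 (p. 259, with (0.31)) is STATED WITHOUT PROOF in print: *"A proof of this theorem, based on perturbative
calculations, will be given in a separate paper, where more precise asymptotic behavior will be proved."*  Its statement is
typed ONCE in the tree — `B12.Thm2Printed C L` (verbatim docstring there; ≃ `Missing.B12Thm2Shape` ≃ `B16.Thm2Shape` by
`B12Thm2Bridge.thm2Printed_iff_missing`, referee finding R5.13 «one typing») — and is NOT re-typed here: every theorem below
CONCLUDES in `B12.Thm2Printed C L` (or in its endpoint half `DagBinding.EndpointExistence C`) literally.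

What print DOES supply towards Theorem 2 is scattered over pp. 255–256, 260–264, 268, 292–298 of [I] and over six tree modules
(`FlowStep`, `FlowStepRuns`, `DagBinding`, `B12Beta`, `B12Sec2to5`, `Beta.RemainderChain`).  This module is the INDEX the
NODE-O cover cell asked for (unit `ymgap-nodeO-typer-1`, 2026-08-30): the printed road as a CHAIN OF NAMED PROP-VALUED
STRUCTURES whose fields are the tree's existing predicates BY NAME (nothing re-declared), in the order print introduces them,
each field's docstring carrying its print locus and its status — PRINTED-DEFINITION ∕ PRINTED-PROVED (in [I]+[II], under
Theorem 3's hypothesis «0 < g_k ≦ γ») ∕ PRINTED-STATED ∕ NOT PRINTED (announced) — plus the kernel-checked compositions: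

* `PrintedSteps C β γ₀ β′` — (P1) forward generation of the runs by (0.17)–(0.20) (`DagBinding.ForwardGenerated`); (P4) the
  β-clause of p. 264, *"uniformly bounded on this interval"*, as the k-uniform TWO-SIDED bound `−β′ ≦ β_{k+1} ≦ β′` on the
  boxes `]0,γ₀]^{k+1}` (`FlowStep.BetaUpperH β′` ∧ `FlowStep.BetaLowerH (−β′)`).  THIS TWO-SIDED BOUND IS THE SHAPE OF NODE O's
  K0⁷ LETTER (the registered stub `∀ F, AbsBetaBoxAtThm1WitnessCCMGenGridGZBAt F` of `Summits/…/BalabanUVNodesK0V23Defs`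
  concludes `∃ γ₀ … β′, … ∧ BetaLowerH (−β′) γ₀ β_record ∧ BetaUpperH β′ γ₀ β_record`) — `PrintedSteps.absBox`.
* `PolarizationRoute β γ₀ μ ν Pol C δ₁` — the PRINTED PROOF of (P4): (P2) the definition (1.20)–(1.22) = (5.42) of β_{k+1} as the
  second moment of the vacuum-polarization kernel (`B12Beta.secondMoment`), (P3) the decay (5.10) p. 293
  (`B12Sec2to5.Decay510`), uniformly in the scale and the history; `PolarizationRoute.printedSteps` = (P2)+(P3) ⟹ (P4) with
  `β′ = β′₅.₁₀ = O(1)E₀·Σ_x |x|₁² e^{−δ₁|x|₁}` (`FlowStepRuns.betaBoundsH_of_decay510`, i.e. sub-cell B12's one undisplayed line).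
* `PerturbativeSteps S γ₀ b r` — over the PRINTED one-loop split `S : B12Beta.OneLoopSplit β` ((1.3) p. 260 *"We have written
  explicitly terms of the order 0 in the coupling constants"*, (2.12)–(2.14) p. 268): (P7) **THE REMAINDER ESTIMATE**
  `Beta.RemainderChain.RemainderConst S γ₀ r` — `|β¹_{k+1}(g_0, …, g_k)| ≦ r` on `]0,γ₀]^{k+1}`, ONE r for all scales k (printed
  CHAIN [II] (2.41) → [I] (4.35)–(4.37), (5.10) → (1.22), assembled in `Beta.RemainderChain.Chain.abs_beta1_le` with
  `r = ε₁·K_rem`, modulo the located leaves listed there) — field `remainder`; and the two inputs print only ANNOUNCES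
  (*"based on perturbative calculations"*): (P8a) the one-loop SIGN∕SIZE `2b ≦ β⁰_{k+1}`, `b > 0` (asymptotic freedom of the
  scheme; p. 259 *"we do not assume any special asymptotic behavior of the coupling constants, like asymptotic freedom"*) —
  field `oneLoopLower`; (P8b) the smallness `r ≦ b` ([II] p. 21, an «ε₁ sufficiently small» restriction) — field `remainder_le`.
* `Skeleton C β S γ₀ β′ b r` — all of the above plus the located letter (C) `FlowStep.BetaContH γ₀ β` (JOINT continuity of
  β_{k+1} on `]0,γ₀]^{k+1}`; print asserts regularity in the LAST coupling only, p. 263 *"It is a C^∞-function of g_{j−1} ∈ [0,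
  γ], (or analytic)"*, p. 264 *"It is a smooth function defined on the interval [0, γ], (or analytic), uniformly bounded on this
  interval together with all derivatives"*; the joint letter is NOT printed for the cut-off (2.9) — p. 266's alternative cut-off
  gives joint analyticity, `B12CouplingClausesHistory.betaContH_of_analyticInCouplings266` — cell DELTA-I D-20).

KERNEL (all `theorem`s below are compositions of landed tree theorems, a few lines each):
`PrintedSteps.endpointK` — WHAT THE PRINTED PART GIVES: with (C), for every FIXED K (ε = L^{−K}) and every renormalised
`g ≦ (1∕γ² + β′K)^{−1∕2}` a bare coupling with the run in `]0,γ]` ending at `g_K = g` (`FlowStepRuns.endpointK_of_absBound`) — the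
ε-DEPENDENT endpoint statement; Theorem 2 asserts `g` small INDEPENDENTLY of ε.  `PerturbativeSteps.betaLowerH` — (P7)+(P8)
⟹ `b ≦ β_{k+1}` on the boxes (`Beta.RemainderChain.betaLowerH_of_split_const`).  `Skeleton.thm2Printed` — THE WHOLE CHAIN ⟹
`B12.Thm2Printed C L` for every real block size `L > 1`, (0.31) constants `b∕log L`, `β′∕log L`
(`FlowStepRuns.thm2Printed_of_boxBoundsH`); `Skeleton.endpointExistence` — ⟹ `DagBinding.EndpointExistence C`.
v2 (§5, APPEND; one import added, `B12Carve26Sect5BetaHyp`): `printedSteps_of_carve26` ∕ `skeleton_of_carve26` — the tree's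
PER-SECTION carving of [I] §5 (block 26, pp. 297–298: `B12Carve26Sect5BetaHyp.Hyp`, with the block-25 decay (5.10) as its explicit
hypothesis) FEEDS `PrintedSteps` ∕ `Skeleton` by that module's own `Hyp.betaUpperH` ∕ `Hyp.betaLowerH_neg`; so the as-printed
section files and this index agree by name.

HONEST FRAMING.  Hypothesis structures and bookkeeping only: NOTHING of Bałaban's series is asserted or discharged; no field of
any structure below is claimed to hold for Bałaban's actual β-functions; Theorem 2 remains UNPROVED IN PRINT and untouched here;
the typed Track-A rung it feeds is the CONDITIONAL finite-torus statement only; the Yang–Mills mass gap (Clay) is NOT proved by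
any of this.  No new named fact (`def … : Prop` asserted true) is introduced — every `def`∕`structure` here is a PREDICATE with
its hypotheses as explicit parameters∕fields (D-0014, D-0026).  Imports `Beta.RemainderChain` (hence `FlowStepRuns`,
`DagBinding`, `FlowStep`, `B12Beta`, `B12Sec2to5`, `B12`) and, from v2, `B12Carve26Sect5BetaHyp` (hence `B12BetaAsPrinted`,
`B12Rep537`); restates none of their declarations.  No `sorry`, no `instance`, no
`notation`.  Companion card (prose, outside the tree): `run/shared/lean/pub/ym-nodeO-ideate/nodeO-cover/TYPER-CARD-v0.md`
(Prop ↔ page∕equation ↔ NODE-O consumer, and the list of printed hypotheses NOT typed faithfully, with reasons).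

NOT typed here (by name elsewhere): the statement itself (`B12.Thm2Printed`); (0.18)∕(0.20) along one run (`FlowStep.RGEqH`,
`Setup.Flow.SatisfiesRG`); the finite-volume tensor (1.20) and the limit (1.21)∕(5.1) (`B12PolarizationTensor120`, `B12Limit51`);
the derivation (5.11)–(5.36) of the representation (5.37) (`B12Rep537`, `B12Sec5Algebra`, `B12LaurentSplit522`); the leaves of
(4.37) ⟹ (5.10) (`B12Decay510`, `B12Decay510SectG`); the last-coupling regularity clauses of pp. 263–264 as printed
(`B12CouplingClausesHistory.BetaSmoothInLast264` ∕ `…AnalyticInLast264` ∕ `…DerivsBoundedInLast264`, `B12BetaAsPrinted.Conclusions`);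
the rigid perturbative form `FlowStep.BetaPertH`; the one-loop coefficient's value∕limit (β sub-cell rows (D1), `Beta.Drift`,
`Beta.OneStepKernelFamily.D1Drift`) — the skeleton takes the one-loop input in the weakest form the literal (0.31) consumes,
`2b ≦ β⁰_{k+1}` for all k.
-/

namespace Literature.MathematicalPhysics.QuantumFieldTheory.Balaban1983to89.B12Thm2PrintSkeleton

open Literature.MathematicalPhysics.QuantumFieldTheory.Balaban1983to89
open FlowStep DagBinding FlowStepRuns Beta.RemainderChain

noncomputable section

/-! ## 1. The printed steps: forward generation (0.17)–(0.20) and the two-sided β-bound of p. 264 -/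

/-- **The PRINTED steps of [Balaban1987RG1] towards Theorem 2**, for a construction `C` (run parameters `(K, m, g₀) ↦` run
data, `B12.Construction`) whose couplings are generated by the history-dependent family `β` (`β k v = β_{k+1}(g_0, …, g_k)`,
p. 298: *"We write β_j as explicitly dependent on g_{j−1}, although it depends also on all preceding coupling constants"*), on
the window `]0,γ₀]` with the bound `β′`:
* `window_pos` — p. 255: *"defined on an interval [0, γ], γ > 0"* (here the window `γ₀` on which the bounds are used).
* `forwardGen` — (P1) PRINTED-DEFINITION, (0.17)–(0.20) pp. 255–256 and (2.15) p. 268: the run starts at the bare coupling and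
  *"the coupling constant g_{k+1} is determined from the equation 1∕g_k² = 1∕g²_{k+1} + β_{k+1}(g_k). (0.20)"*, solved forward
  (`DagBinding.ForwardGenerated`).
* `absUpper`, `absLower` — (P4) PRINTED-STATED p. 264 (the β-clause closing the inductive assumptions: *"It is a smooth function
  defined on the interval [0, γ], (or analytic), uniformly bounded on this interval together with all derivatives."*) and
  PRINTED-PROVED in [I] §5 under Theorem 3's hypothesis via (5.10)+(5.42) (`PolarizationRoute.printedSteps` below): the
  k-uniform two-sided bound `−β′ ≦ β_{k+1}(g_0, …, g_k) ≦ β′` on `]0,γ₀]^{k+1}` — THE SHAPE OF NODE O's K0⁷ LETTER.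
A structure of HYPOTHESES; asserted for no `β`. [cite: Balaban1987RG1, (0.17)–(0.20) pp.255–256 and §1 p.264] -/
structure PrintedSteps (C : B12.Construction) (β : HBeta) (γ₀ β' : ℝ) : Prop where
  window_pos : 0 < γ₀
  forwardGen : ForwardGenerated C β
  absUpper : BetaUpperH β' γ₀ β
  absLower : BetaLowerH (-β') γ₀ β

namespace PrintedSteps

variable {C : B12.Construction} {β : HBeta} {γ₀ β' : ℝ}

/-- The printed two-sided bound forces `0 ≦ β′` (evaluate `−β′ ≦ β₁(γ₀) ≦ β′` at the constant history γ₀; bookkeeping on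
the β-clause of p. 264). [cite: Balaban1987RG1, §1 p.264] -/
theorem bound_nonneg (P : PrintedSteps C β γ₀ β') : 0 ≤ β' := by
  have hmem : (fun _ : Fin (0 + 1) => γ₀) ∈ Box γ₀ 0 := mem_box.mpr fun _ => ⟨P.window_pos, le_rfl⟩
  have h1 := P.absLower 0 _ hmem
  have h2 := P.absUpper 0 _ hmem
  linarith

/-- **NODE O's K0⁷ letter shape, read off the printed steps**: the sign-free box `BetaLowerH (−β′) γ₀ β ∧ BetaUpperH β′ γ₀ β`
with `0 < γ₀` — literally the last three conjuncts of the registered K0⁷ stub text `AbsBetaBoxAtThm1WitnessCCMGenGridGZBAt`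
(there for `β = betaOfRecord₁₃ …` at the witness record).  Bookkeeping. [cite: Balaban1987RG1, §1 p.264] -/
theorem absBox (P : PrintedSteps C β γ₀ β') : 0 < γ₀ ∧ BetaLowerH (-β') γ₀ β ∧ BetaUpperH β' γ₀ β :=
  ⟨P.window_pos, P.absLower, P.absUpper⟩

/-- **WHAT THE PRINTED PART GIVES (per ε).**  Printed steps + the located joint-continuity letter (C): for every torus exponent
`m`, every `γ ∈ ]0,γ₀]`, every FIXED `K` (ε = L^{−K}) and every renormalised coupling `g` with `1∕g² ≧ 1∕γ² + β′K` there is a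
bare coupling `g₀` whose run stays in `]0,γ]` and ends at `g_K = g` (`FlowStepRuns.endpointK_of_absBound`).  Theorem 2's first
sentence asserts the same with `g` small INDEPENDENTLY of `K`; the difference is exactly the K-uniform lower control of the
β's that print does not supply (`PerturbativeSteps`).  A reduction, not a claim about the series. [cite: Balaban1987RG1, Thm 2 p.259 and §1 p.264] -/
theorem endpointK (P : PrintedSteps C β γ₀ β') (hcont : BetaContH γ₀ β) (m : ℕ) {γ : ℝ} (hγ : 0 < γ)
    (hγle : γ ≤ γ₀) (K : ℕ) {g : ℝ} (hg : 0 < g) (hgK : 1 / γ ^ 2 + β' * K ≤ 1 / g ^ 2) :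
    ∃ g0 : ℝ, (C ⟨K, m, g0⟩).flow.InInterval γ K ∧ (C ⟨K, m, g0⟩).flow.g K = g :=
  endpointK_of_absBound P.forwardGen P.bound_nonneg hcont P.absLower P.absUpper m hγ hγle K hg hgK

end PrintedSteps

/-! ## 2. The printed proof of the two-sided bound: (1.20)–(1.22)∕(5.42) and (5.10) -/

/-- **The PRINTED ROAD to the two-sided bound (P4)** — [I] §1 p. 264 and §5 pp. 292–297, for the family `β` on the window
`]0,γ₀]`, a pair of directions `μ ≠ ν` (print: *"for μ, ν arbitrary, μ ≠ ν"*), the vacuum-polarization kernels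
`Pol k v = Π_{k+1}(g_0, …, g_k; ·)` on ℤ^d after the limit (1.21)∕(5.1), and the constants `C` (= the printed O(1)E₀) and `δ₁`
of (5.10):
* `moment` — (P2) PRINTED-DEFINITION, (1.22) p. 264 = (5.42) p. 297 (*"This is the fundamental equality defining the
  β-function"*): `β_{k+1}(g_0, …, g_k) = Σ_x Π_{k+1,μν}(g_0, …, g_k; x) x_μ x_ν` (`B12Beta.secondMoment`, no prefactor — as printed).
* `decay` — (P3) PRINTED-PROVED in [I] §§3–5 under Theorem 3's hypothesis (the history in `]0,γ]`), p. 293: *"The representation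
  (4.37) yields the following inequality |Π_{μν}(x − y)| ≦ O(1)E₀ exp(−δ₁|x − y|), (5.10)"* — uniformly in the scale and the
  history (the printed constants are k-free: `Beta.RemainderChain` §1 table); leaves located in `B12Decay510` (GAPS G-B12s-15).
* `rate_pos` — p. 293: *"with a positive constant δ₁"*.
A structure of HYPOTHESES; asserted for no `β`. [cite: Balaban1987RG1, (1.20)–(1.22) p.264, (5.10) p.293, (5.42) p.297] -/
structure PolarizationRoute (β : HBeta) (γ₀ : ℝ) {d : ℕ} (μ ν : Fin d)
    (Pol : (k : ℕ) → (Fin (k + 1) → ℝ) → B12Beta.Kernel d) (C δ₁ : ℝ) : Prop where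
  moment : ∀ k v, β k v = B12Beta.secondMoment (Pol k v) μ ν
  decay : ∀ k v, v ∈ Box γ₀ k → B12Sec2to5.Decay510 (Pol k v μ ν) C δ₁
  rate_pos : 0 < δ₁

namespace PolarizationRoute

variable {β : HBeta} {γ₀ : ℝ} {d : ℕ} {μ ν : Fin d} {Pol : (k : ℕ) → (Fin (k + 1) → ℝ) → B12Beta.Kernel d} {C δ₁ : ℝ}

/-- **(P2)+(P3) ⟹ (P4), kernel-checked** (= `FlowStepRuns.betaBoundsH_of_decay510`): the polarization route gives the two-sided
bound with `β′ = β′₅.₁₀ := B12Sec2to5.betaPrime510 d C δ₁ = C·Σ_x |x|₁² e^{−δ₁|x|₁}` — the k-uniform ABSOLUTE bound §5 actually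
yields (p. 264 "uniformly bounded"); no sign, no lower bound `b > 0`. [cite: Balaban1987RG1, (5.10) p.293 and (5.42) p.297] -/
theorem absBounds (R : PolarizationRoute β γ₀ μ ν Pol C δ₁) :
    BetaUpperH (B12Sec2to5.betaPrime510 d C δ₁) γ₀ β ∧ BetaLowerH (-B12Sec2to5.betaPrime510 d C δ₁) γ₀ β :=
  betaBoundsH_of_decay510 μ ν Pol β R.rate_pos R.moment R.decay

/-- The polarization route, forward generation and a positive window assemble the printed steps with `β′ = β′₅.₁₀`.
[cite: Balaban1987RG1, (0.20) p.256, (5.10) p.293, (5.42) p.297] -/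
theorem printedSteps {Cn : B12.Construction} (R : PolarizationRoute β γ₀ μ ν Pol C δ₁) (hγ₀ : 0 < γ₀)
    (hgen : ForwardGenerated Cn β) : PrintedSteps Cn β γ₀ (B12Sec2to5.betaPrime510 d C δ₁) :=
  ⟨hγ₀, hgen, R.absBounds.1, R.absBounds.2⟩

end PolarizationRoute

/-! ## 3. The announced ("perturbative") steps over the printed one-loop split, with THE REMAINDER ESTIMATE by name -/

/-- **The PERTURBATIVE steps towards Theorem 2** over the PRINTED ONE-LOOP SPLIT `S` of the family `β`
(`β_{k+1} = β⁰_{k+1} + β¹_{k+1}(g_0, …, g_k)`: (1.3) p. 260 *"We have written explicitly terms of the order 0 in the coupling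
constants"*; (2.12)–(2.14) p. 268, *"Let us remark that the expression under the exponential above vanishes at g_k = 0"*;
`B12Beta.OneLoopSplit`), on the window `]0,γ₀]`, with one-loop floor `b` and remainder size `r`:
* `slope_pos` — `0 < b`.
* `oneLoopLower` — (P8a) NOT PRINTED (announced p. 259: *"A proof of this theorem, based on perturbative calculations, will be
  given in a separate paper"*; [Balaban1989LargeFieldII] p. 355 *"second order perturbative calculations … has not been published
  yet"*): the one-loop coefficients are bounded below, `2b ≦ β⁰_{k+1}` for every scale k (the discrete asymptotic freedom of the
  scheme; p. 259: *"we do not assume any special asymptotic behavior of the coupling constants, like asymptotic freedom"*).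
* `remainder` — (P7) **THE REMAINDER ESTIMATE**: `|β¹_{k+1}(g_0, …, g_k)| ≦ r` for every k and every history in `]0,γ₀]^{k+1}`
  (`Beta.RemainderChain.RemainderConst`); PRINTED as a CHAIN — [Balaban1988RG2Cluster] (2.41) p. 21 (activity `O(1)C₃ε₁` of the
  (2.13)-terms) → [I] (4.35)–(4.37) pp. 290–291, (5.10) p. 293 → (1.22) p. 264 — assembled in the kernel as
  `Beta.RemainderChain.Chain.abs_beta1_le` with `r = ε₁·K_rem`, modulo the located leaves listed in that module's header §7.
* `remainder_le` — (P8b) the smallness `r ≦ b`: a restriction of the printed type «ε₁ sufficiently small given the preceding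
  constants» ([II] p. 21, next to *"O(1)C₃ε₁ ≦ ½E₀"*; γ is chosen after ε₁, [I] Thm 3 p. 264 *"The constant γ depends on all
  other constants."*), NOT displayed in print for this purpose.
A structure of HYPOTHESES; asserted for no `β`. [cite: Balaban1987RG1, (1.3) p.260, (2.12)–(2.14) p.268, Thm 2 p.259; Balaban1988RG2Cluster, (2.41) p.21] -/
structure PerturbativeSteps {β : HBeta} (S : B12Beta.OneLoopSplit β) (γ₀ b r : ℝ) : Prop where
  slope_pos : 0 < b
  oneLoopLower : ∀ k, 2 * b ≤ S.β0 k
  remainder : RemainderConst S γ₀ r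
  remainder_le : r ≤ b

namespace PerturbativeSteps

variable {β : HBeta} {S : B12Beta.OneLoopSplit β} {γ₀ b r : ℝ}

/-- **(P6)+(P7)+(P8) ⟹ the positive lower bound `b ≦ β_{k+1}` on every box `]0,γ₀]^{k+1}`** — the input `hlo` of
`FlowStepRuns.thm2Printed_of_boxBoundsH` that no printed statement supplies (= `Beta.RemainderChain.betaLowerH_of_split_const`:
`β = β⁰ + β¹ ≧ 2b − r ≧ b`). [cite: Balaban1987RG1, Thm 2 p.259] -/
theorem betaLowerH (A : PerturbativeSteps S γ₀ b r) : BetaLowerH b γ₀ β :=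
  betaLowerH_of_split_const S A.oneLoopLower A.remainder A.remainder_le

end PerturbativeSteps

/-! ## 4. The whole chain and its two conclusions -/

/-- **THE PRINT SKELETON OF [Balaban1987RG1] THEOREM 2**: the printed steps (§1), the perturbative steps over the printed
one-loop split (§3), and the located letter (C) `jointCont` — JOINT continuity of each `β_{k+1}` on `]0,γ₀]^{k+1}`
(`FlowStep.BetaContH`; print: p. 263 *"It is a C^∞-function of g_{j−1} ∈ [0, γ], (or analytic)"* and p. 264 *"a smooth function
defined on the interval [0, γ]"* — the LAST coupling only; joint regularity is not printed for the cut-off (2.9), cf. p. 266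
*"It has the advantage that the functions 𝐄^{(j)}, β_j are analytic functions of the effective coupling constants"* for the
alternative cut-off; cell DELTA-I D-20, GAPS G-adv2-3∕G-adv2-6).  Parameters: construction `C`, family `β`, split `S`, window
`γ₀`, two-sided bound `β′`, one-loop floor `b`, remainder size `r`.  A structure of HYPOTHESES; asserted for no `β`; its two
conclusions below are REDUCTIONS. [cite: Balaban1987RG1, Thm 2 (0.31) p.259, §1 pp.263–264, (2.12)–(2.15) p.268] -/
structure Skeleton (C : B12.Construction) (β : HBeta) (S : B12Beta.OneLoopSplit β) (γ₀ β' b r : ℝ) : Prop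
    extends PrintedSteps C β γ₀ β', PerturbativeSteps S γ₀ b r where
  jointCont : BetaContH γ₀ β

namespace Skeleton

variable {C : B12.Construction} {β : HBeta} {S : B12Beta.OneLoopSplit β} {γ₀ β' b r : ℝ}

/-- Along the skeleton the one-loop floor sits below the two-sided bound, `b ≦ β′` — the printed relation *"there exist
constants β, β′, 0 < β ≦ β′"* of Theorem 2 between the (0.31) constants (here before division by `log L`); bookkeeping.
[cite: Balaban1987RG1, Thm 2 p.259] -/
theorem floor_le_bound (Sk : Skeleton C β S γ₀ β' b r) : b ≤ β' :=
  have hmem : (fun _ : Fin (0 + 1) => γ₀) ∈ Box γ₀ 0 := mem_box.mpr fun _ => ⟨Sk.window_pos, le_rfl⟩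
  (Sk.toPerturbativeSteps.betaLowerH 0 _ hmem).trans (Sk.absUpper 0 _ hmem)

/-- **THE WHOLE CHAIN ⟹ THEOREM 2 AS PRINTED, (0.31) included** — for every real block size `L > 1` (print p. 251: *"L is an
odd, positive integer > 11"*), with (0.31) constants `β = b∕log L`, `β′∕log L` (`log(L^kε)^{−1} = (K − k) log L`); composition
of `PerturbativeSteps.betaLowerH` with `FlowStepRuns.thm2Printed_of_boxBoundsH`.  The conclusion is LITERALLY the tree's single
typing `B12.Thm2Printed C L`.  A REDUCTION to the fields of the skeleton — of which `oneLoopLower`, `remainder_le`, `jointCont`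
and the leaves behind `remainder`∕`absUpper`∕`absLower` are supplied by no printed statement; NOT Theorem 2. [cite: Balaban1987RG1, Thm 2 (0.31) p.259] -/
theorem thm2Printed (Sk : Skeleton C β S γ₀ β' b r) {L : ℝ} (hL : 1 < L) : B12.Thm2Printed C L :=
  thm2Printed_of_boxBoundsH Sk.forwardGen hL Sk.window_pos Sk.slope_pos Sk.floor_le_bound Sk.jointCont
    Sk.toPerturbativeSteps.betaLowerH Sk.absUpper

/-- **THE WHOLE CHAIN ⟹ the endpoint half of Theorem 2** (`DagBinding.EndpointExistence C`: ∀ m ∃ γ₂ ∀ γ ∃ g⋆ ∀ g ∀ K ∃ g₀,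
run in `]0,γ]` with `g_K = g` — the first sentence of Theorem 2, the hypothesis [Balaban1989LargeFieldII] Thm 1 consumes); via
`FlowStepRuns.endpointExistence_of_eventualLower` with `k₀ = 0`.  A REDUCTION, as above. [cite: Balaban1987RG1, Thm 2 p.259 (first sentence)] -/
theorem endpointExistence (Sk : Skeleton C β S γ₀ β' b r) : EndpointExistence C :=
  endpointExistence_of_eventualLower (k₀ := 0) Sk.forwardGen Sk.window_pos Sk.slope_pos.le Sk.bound_nonneg Sk.jointCont
    (fun k _ v hv => Sk.toPerturbativeSteps.betaLowerH k v hv) (fun k v hv => Sk.absLower k v hv) Sk.absUpper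

end Skeleton

/-- **Assembling the skeleton from the printed polarization route** (§2) instead of the bare two-sided bound: forward
generation + (1.22)∕(5.10) on the window + the perturbative steps + (C) give the skeleton with `β′ = β′₅.₁₀`, hence Theorem 2
as printed for every `L > 1` (`Skeleton.thm2Printed`).  Every PRINTED input of [I] towards Theorem 2 enters this theorem by
name; the remaining fields are the located unprinted ones. [cite: Balaban1987RG1, Thm 2 (0.31) p.259, (5.10) p.293, (5.42) p.297] -/
theorem skeleton_of_polarizationRoute {C : B12.Construction} {β : HBeta} {S : B12Beta.OneLoopSplit β} {γ₀ b r : ℝ}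
    {d : ℕ} {μ ν : Fin d} {Pol : (k : ℕ) → (Fin (k + 1) → ℝ) → B12Beta.Kernel d} {Cst δ₁ : ℝ}
    (hγ₀ : 0 < γ₀) (hgen : ForwardGenerated C β) (R : PolarizationRoute β γ₀ μ ν Pol Cst δ₁)
    (A : PerturbativeSteps S γ₀ b r) (hcont : BetaContH γ₀ β) :
    Skeleton C β S γ₀ (B12Sec2to5.betaPrime510 d Cst δ₁) b r :=
  { R.printedSteps hγ₀ hgen, A with jointCont := hcont }

/-! ## 5. The per-section carving feeds the skeleton: [I] §5 block 26 (pp. 297–298) with (5.10) ⟹ the printed steps -/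

/-- **The §5 carving of record feeds the skeleton.**  The tree's per-section hypothesis bundle of [I] pp. 297–298
(`B12Carve26Sect5BetaHyp.Hyp X`: (5.36)–(5.38) with p. 298 l. 5 as `B12Rep537.TaylorData3`, (5.44)), together with the block-25
decay (5.10) p. 293 on the printed coupling domain `B12BetaAsPrinted.histDom X.γ j`, a positive window and forward generation, IS a
`PrintedSteps` package for the carrier's family `X.β` with `β′ = β′₅.₁₀ = B12Sec2to5.betaPrime510 4 C X.δ₁` — by that module's own
`Hyp.betaUpperH` ∕ `Hyp.betaLowerH_neg` (p. 264 «uniformly bounded» out of (5.42)+(5.10)).  So the as-printed §5 file and this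
index agree by name; bookkeeping, nothing asserted. [cite: Balaban1987RG1, (5.36)–(5.38) and (5.42) p.297 with (5.10) p.293 and p.264 (bookkeeping)] -/
theorem printedSteps_of_carve26 {X : B12Carve26Sect5BetaHyp.Carriers} (hX : B12Carve26Sect5BetaHyp.Hyp X)
    (hδ : 0 < X.δ₁) {C : ℝ}
    (h510 : ∀ (j : ℕ) (h : Fin (j + 1) → ℝ), h ∈ B12BetaAsPrinted.histDom X.γ j → ∀ μ ν : Fin 4,
      B12Sec2to5.Decay510 (X.pol j h μ ν) C X.δ₁)
    (hγ : 0 < X.γ) {Cn : B12.Construction} (hgen : ForwardGenerated Cn X.β) :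
    PrintedSteps Cn X.β X.γ (B12Sec2to5.betaPrime510 4 C X.δ₁) :=
  ⟨hγ, hgen, hX.betaUpperH hδ h510, hX.betaLowerH_neg hδ h510⟩

/-- … hence, with the perturbative steps and the located letter (C), the whole skeleton — and Theorem 2 as printed for every
`L > 1` (`Skeleton.thm2Printed`) — from the §5 carving + (5.10) + the unprinted inputs, all by name. [cite: Balaban1987RG1, Thm 2 (0.31) p.259 with (5.42) p.297 and (5.10) p.293 (bookkeeping)] -/
theorem skeleton_of_carve26 {X : B12Carve26Sect5BetaHyp.Carriers} (hX : B12Carve26Sect5BetaHyp.Hyp X)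
    (hδ : 0 < X.δ₁) {C : ℝ}
    (h510 : ∀ (j : ℕ) (h : Fin (j + 1) → ℝ), h ∈ B12BetaAsPrinted.histDom X.γ j → ∀ μ ν : Fin 4,
      B12Sec2to5.Decay510 (X.pol j h μ ν) C X.δ₁)
    (hγ : 0 < X.γ) {Cn : B12.Construction} (hgen : ForwardGenerated Cn X.β) {S : B12Beta.OneLoopSplit X.β} {b r : ℝ}
    (A : PerturbativeSteps S X.γ b r) (hcont : BetaContH X.γ X.β) :
    Skeleton Cn X.β S X.γ (B12Sec2to5.betaPrime510 4 C X.δ₁) b r :=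
  { printedSteps_of_carve26 hX hδ h510 hγ hgen, A with jointCont := hcont }

end

end Literature.MathematicalPhysics.QuantumFieldTheory.Balaban1983to89.B12Thm2PrintSkeleton
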